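import Summits.BirchSwinnertonDyer.Rank1Residual.P2.CornerFTwoCertificatesKrizLi
import Literature.NumberTheory.EllipticCurves.Rank1Residual.CornerFTwoCertificates.RecordsKrizLiTwoFortyThree
import HarnessLib

/-!
# Cell `bsd-print-cf2` (D-0131 (2) PRINT TIER, leaf CornerF @ `p = 2`), seat ty3 — the Kriz–Li family at
# `(243a1, ℚ(√−23))` DISPLAYED: `ord_{s=1} L = 1 ∧ BSD(·, 2)` BY NAME for the minimal model of every
# certified member, member by member (INERT-GOOD quadrant; currency PRINT(TABLE))

HONEST FRAMING (cell `bsd-print-cf2`, run/shared/lean/pub/bsd-print-cf2/; verbatim): PARTITION currency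
only — the leaf counts when its class theorem is in the kernel BY NAME; every imported theorem carries its
printed hypotheses verbatim. The leaf is OPEN AS A CLASS; nothing class-wide is closed here; theorems
only, no definition, no named fact. This file joins the glue `P2/CornerFTwoCertificatesKrizLi.lean` (what a
certified Kriz–Li record at the base `243a1` gives by name) to the certified record list
`Literature/…/CornerFTwoCertificates/RecordsKrizLiTwoFortyThree.lean` (26 members `243a1^{(d)}`, `d ≤ 3000`,
kernel-certified by `decide`, two engines agreeing): for every listed member, the minimal model
`W_d = ⟨0, 0, 1, 0, a₆⟩` (`4a₆ + 1 = −3d³`) is a globally minimal elliptic curve with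
`ord_{s=1} L(W_d, s) = 1` and Miller's `BSD(W_d, 2)`, and every `ℚ`-model of `243a1^{(d)}` / `243a1^{(−23d)}`
has `BSD(·, 2)` — granted exactly p3's binders `hKL h33 htab hS31 hBF hmod`. In the cell's partition these
are finite certified samples of the closed sub-cell KL243 (aside 20766; generic (★)-door 21366).
beyond-print theorem: NO.

References: [KrizLi2019] Thm 1.12 (FMS 5.1), Thm 4.3, Def 4.1, Table 1; [CreutzMiller2012] Thm 1.1;
[BurungaleFlach2024] Cor 2; [Miller2011LMS] Def 1.1.
-/

noncomputable section

open scoped Classical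

open WeierstrassCurve NumberField Literature.NumberTheory.EllipticCurves
  Literature.NumberTheory.EllipticCurves.Rank1Residual
  Literature.NumberTheory.EllipticCurves.ModularForms
  Literature.NumberTheory.EllipticCurves.Rank1Residual.CornerFTwoCertificates
  Summit.BirchSwinnertonDyer.Rank1Residual

set_option autoImplicit false

namespace Summit.BirchSwinnertonDyer.Rank1Residual.P2

/-- **`BSD(W, 2)` for every `ℚ`-model of `243a1^{(d)}` or `243a1^{(−23d)}`, for each of the 26 certified
members**, BY NAME (binders `hKL h33 htab hS31 hBF hmod`). [cite: KrizLi2019, Thm. 1.12 (FMS Thm. 5.1 (2)), Def. 4.1, Lemma 5.1 and §6 Table 1 (row 243a1)] [cite: CreutzMiller2012, Thm. 1.1]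
[cite: BurungaleFlach2024, Thm. 1.1 and Cor. 2] [cite: Miller2011LMS, Def. 1.1] -/
theorem bsdp_two_of_mem_recordsKrizLiTwoFortyThree (hKL : KrizLi2019.thm112_bsdTwo_twist)
    (h33 : KrizLi2019.thm33_rank_twist) (htab : KrizLi2019.table1_row243a1)
    (hS31 : bsdTriple_of_analyticRank_le_one_of_conductor_lt) (hBF : bsdTriple_of_hasCM_of_L_one_ne_zero)
    (hmod : hasEntireLFunction_rat) :
    ∀ r ∈ recordsKrizLiTwoFortyThree, ∀ (W : WeierstrassCurve ℚ) [W.IsElliptic] [W.IsGloballyMinimal] (C : VariableChange ℚ),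
      (C • curve243a1.quadraticTwist ((r.d : ℤ) : ℚ) = W ∨
        C • curve243a1.quadraticTwist ((-23 * (r.d : ℤ) : ℤ) : ℚ) = W) → BSDp W 2 :=
  fun r hr W _ _ C hC =>
    bsdp_two_of_klCertified_243 hKL h33 htab hS31 hBF hmod certified_recordsKrizLiTwoFortyThree r hr
      (base_of_mem_recordsKrizLiTwoFortyThree r hr).1 (base_of_mem_recordsKrizLiTwoFortyThree r hr).2.1 (base_of_mem_recordsKrizLiTwoFortyThree r hr).2.2.1 W C hC

/-- **THE MINIMAL MODELS ON THE NOSE, member by member**: for each of the 26 certified records `r`, the curve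
`⟨0, 0, 1, 0, a₆⟩` read off `r.ainvs = [0,0,1,0,a₆]` (list `models_recordsKrizLiTwoFortyThree`) is a globally minimal elliptic
curve with `ord_{s=1} L = 1 ∧ BSD(·, 2)`, BY NAME. [cite: KrizLi2019, Thm. 1.12 (FMS Thm. 5.1 (2)), Def. 4.1, Lemma 5.1 and §6 Table 1 (row 243a1)] [cite: CreutzMiller2012, Thm. 1.1]
[cite: BurungaleFlach2024, Cor. 2] [cite: SilvermanAEC2009, VII.1 Remark 1.1] [cite: Miller2011LMS, Def. 1.1] -/
theorem analyticRank_eq_one_and_bsdp_two_of_mem_recordsKrizLiTwoFortyThree (hKL : KrizLi2019.thm112_bsdTwo_twist)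
    (h33 : KrizLi2019.thm33_rank_twist) (htab : KrizLi2019.table1_row243a1)
    (hS31 : bsdTriple_of_analyticRank_le_one_of_conductor_lt) (hBF : bsdTriple_of_hasCM_of_L_one_ne_zero)
    (hmod : hasEntireLFunction_rat) :
    ∀ r ∈ recordsKrizLiTwoFortyThree, ∃ a6 : ℤ, r.ainvs = [0, 0, 1, 0, a6] ∧
      ∃ (_ : (⟨((0 : ℤ) : ℚ), ((0 : ℤ) : ℚ), ((1 : ℤ) : ℚ), ((0 : ℤ) : ℚ), (a6 : ℚ)⟩ : WeierstrassCurve ℚ).IsElliptic)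
        (_ : (⟨((0 : ℤ) : ℚ), ((0 : ℤ) : ℚ), ((1 : ℤ) : ℚ), ((0 : ℤ) : ℚ), (a6 : ℚ)⟩ : WeierstrassCurve ℚ).IsGloballyMinimal),
        (⟨((0 : ℤ) : ℚ), ((0 : ℤ) : ℚ), ((1 : ℤ) : ℚ), ((0 : ℤ) : ℚ), (a6 : ℚ)⟩ : WeierstrassCurve ℚ).analyticRank = 1 ∧
          BSDp (⟨((0 : ℤ) : ℚ), ((0 : ℤ) : ℚ), ((1 : ℤ) : ℚ), ((0 : ℤ) : ℚ), (a6 : ℚ)⟩ : WeierstrassCurve ℚ) 2 :=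
  fun r hr =>
    analyticRank_eq_one_and_bsdp_two_of_klCertified_243 hKL h33 htab hS31 hBF hmod certified_recordsKrizLiTwoFortyThree r hr
      (base_of_mem_recordsKrizLiTwoFortyThree r hr).1 (base_of_mem_recordsKrizLiTwoFortyThree r hr).2.1 (base_of_mem_recordsKrizLiTwoFortyThree r hr).2.2.1
      (base_of_mem_recordsKrizLiTwoFortyThree r hr).2.2.2

end Summit.BirchSwinnertonDyer.Rank1Residual.P2

end
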